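import Literature.AlgebraicGeometry.Modules.SheafHomFunctor
import Literature.AlgebraicGeometry.Motives.AbelianVarietyTangentSheafFree
import Literature.AlgebraicGeometry.GroupSchemes.CotangentSheafFreeOverLocalRing
import Mathlib.Algebra.Category.ModuleCat.Sheaf.Free
import Mathlib.CategoryTheory.Limits.Shapes.Biproducts
import Mathlib.CategoryTheory.Preadditive.Biproducts
import HarnessLib

/-!
# Projections and inclusions of a finite global frame: `E ≅ 𝒪_X^I` as module MAPS `π_a : E → 𝒪_X`,
# `σ_a : 𝒪_X → E` with `∑ π_a σ_a = 𝟙`, `σ_a π_b = δ_{ab}`; the tangent / cotangent frames of an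
# abelian variety (abelian scheme over a local ring) in this form

A global frame of an `𝒪_X`-module, `e : E ≅ 𝒪_X^I = SheafOfModules.free I` (`I` finite), is the same
as a biproduct decomposition of `E` into `I` copies of `𝒪_X = unitModule X`: comparing the coproduct
`free I` (Mathlib `SheafOfModules.isColimitFreeCofan`) with the biproduct `⨁_I 𝒪_X` of the preadditive
category `Mod(𝒪_X)` (Mathlib `biproduct.isColimit`) gives MODULE MORPHISMS

  `π_a := e ≫ (free I ≅ ⨁) ≫ pr_a : E ⟶ 𝒪_X`,  `σ_a := ι_a ≫ (⨁ ≅ free I) ≫ e⁻¹ = ιFree a ≫ e⁻¹ : 𝒪_X ⟶ E`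

with `∑_a π_a ≫ σ_a = 𝟙_E` (Mathlib `IsBilimit.total`) and `σ_a ≫ π_b = δ_{ab}` (`biproduct.ι_π`)
([Hartshorne1977] II §5: a free module of rank `n` is the direct sum of `n` copies of `𝒪_X`;
[StacksProject, Tag 01ED] for the use: Čech cochains of `E` are read componentwise through the `π_a`).
This is the shape in which a frame is CONSUMED at cochain level — e.g. the binder block
`(π σ) (hπσ : ∑ a, π a ≫ σ a = 𝟙 M)` of a componentwise Čech criterion — whereas
`Morphisms/CechModuleH2Biproduct` delivers the induced splitting of `Ȟ²` classes.

* `Modules.exists_frameMaps_of_iso_free` — the generic statement above;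
* `Motives.AbelianVariety.exists_frameMaps_tangentSheaf`, `…_cotangentSheaf` — for an abelian variety
  over a field, from the tree's frames `𝒯_A ≅ 𝒪_A^{dim A}` (`Motives/AbelianVarietyTangentSheafFree`) and
  `Ω¹_A ≅ 𝒪_A^{dim A}` ([MumfordAV1970] §4 (iii): «`Ω¹` is free, generated by the invariant
  differentials»; tree `Mumford1970_cotangentSheaf_abelianVariety_free_holds`);
* `AbelianSchemes.AbelianSchemeOver.exists_frameMaps_tangentSheaf_of_isLocalRing`, `…_cotangentSheaf_…` —
  for an abelian scheme of relative dimension `g` over a local ring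
  (tree `GroupSchemes/CotangentSheafFreeOverLocalRing`, [BoschLutkebohmertRaynaud1990] §4.2 Prop. 2).

THEOREMS ONLY (no definition, no named fact, no instance, no `sorry`); families are typed
`I → X.Modules` (`fun _ => unitModule X`) — see the design note of `Morphisms/CechModuleH2Biproduct`.
Cell hodgecm-mathlib (D-0151), F-11 α1 / J4-(iv) brick (iv-2b)(α) (the `(π, σ, hπσ)` slot of the
GAP-2 backbone `CechModuleH2ScalingVanishing`); HC_CM is proved only modulo the 7 printed citations
until rung 0 closes — nothing here bears on it.

## References

* R. Hartshorne, *Algebraic Geometry*, GTM 52 (1977), II §5 (p. 109: free and locally free sheaves).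
  [Hartshorne1977]
* The Stacks Project, Tag 01ED (the Čech complex is functorial in the sheaf). [StacksProject]
* D. Mumford, *Abelian Varieties* (1970), §4 (iii) p. 42. [MumfordAV1970]
* S. Bosch, W. Lütkebohmert, M. Raynaud, *Néron Models* (1990), §4.2 Prop. 2 (p. 100).
  [BoschLutkebohmertRaynaud1990]
-/

noncomputable section

open CategoryTheory AlgebraicGeometry Limits TopologicalSpace Opposite

universe u

namespace Literature.AlgebraicGeometry.Modules

variable {X : Scheme.{u}} (I : Type u)

/-- `⨁_I 𝒪_X` exists in `Mod(𝒪_X)` for `I` finite (finite biproducts from finite products). [folklore] -/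
private theorem hasBiproduct_unitModule [Finite I] : HasBiproduct fun _ : I => unitModule X := by
  haveI : HasFiniteBiproducts X.Modules := HasFiniteBiproducts.of_hasFiniteProducts
  infer_instance

/-- The comparison `⨁_I 𝒪_X ≅ 𝒪_X^I` of the two coproducts matches the inclusions: there is
`c : ⨁_I 𝒪_X ≅ free I` with `ι_a ≫ c = ιFree a`. [folklore] -/
private theorem exists_iso_free_comp_ι [HasBiproduct fun _ : I => unitModule X] :
    ∃ c : (⨁ fun _ : I => unitModule X) ≅ SheafOfModules.free (R := X.ringCatSheaf) I,
      ∀ a, biproduct.ι (fun _ : I => unitModule X) a ≫ c.hom =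
        SheafOfModules.ιFree (R := X.ringCatSheaf) a :=
  ⟨IsColimit.coconePointUniqueUpToIso (biproduct.isColimit fun _ : I => unitModule X)
      (SheafOfModules.isColimitFreeCofan (R := X.ringCatSheaf) I),
    fun a => by
      have h := IsColimit.comp_coconePointUniqueUpToIso_hom
        (biproduct.isColimit fun _ : I => unitModule X)
        (SheafOfModules.isColimitFreeCofan (R := X.ringCatSheaf) I) ⟨a⟩
      simp only [Bicone.toCocone_pt, Bicone.toCocone_ι_app, SheafOfModules.freeCofan,
        Cofan.mk_ι_app] at h
      exact h⟩

/-- **Projections and inclusions of a finite global frame.**  For an `𝒪_X`-module `E` with a frame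
`e : E ≅ 𝒪_X^I` (`I` finite) there are module maps `π_a : E ⟶ 𝒪_X`, `σ_a : 𝒪_X ⟶ E` (`a : I`) with
`∑_a π_a ≫ σ_a = 𝟙_E`, `σ_a ≫ π_a = 𝟙`, `σ_a ≫ π_b = 0` for `a ≠ b`, and `σ_a = ιFree a ≫ e⁻¹` (the
`a`-th basis section of the frame). [cite: Hartshorne1977, II §5 (p. 109)]
[cite: StacksProject, Tag 01ED (Cohomology, Section 20.9)] -/
theorem exists_frameMaps_of_iso_free [Fintype I] {E : X.Modules}
    (e : E ≅ SheafOfModules.free (R := X.ringCatSheaf) I) :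
    ∃ (π : I → (E ⟶ unitModule X)) (σ : I → (unitModule X ⟶ E)),
      (∑ a, π a ≫ σ a = 𝟙 E) ∧ (∀ a, σ a ≫ π a = 𝟙 _) ∧ (∀ a b, a ≠ b → σ a ≫ π b = 0) ∧
        ∀ a, σ a = SheafOfModules.ιFree (R := X.ringCatSheaf) a ≫ e.inv := by
  haveI := hasBiproduct_unitModule (X := X) I
  obtain ⟨c, hc⟩ := exists_iso_free_comp_ι (X := X) I
  refine ⟨fun a => e.hom ≫ c.inv ≫ biproduct.π (fun _ : I => unitModule X) a,
    fun a => biproduct.ι (fun _ : I => unitModule X) a ≫ c.hom ≫ e.inv, ?_, fun a => ?_,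
    fun a b hab => ?_, fun a => ?_⟩
  · -- `∑ (e ≫ c⁻¹ ≫ πₐ) ≫ (ιₐ ≫ c ≫ e⁻¹) = e ≫ c⁻¹ ≫ (∑ πₐ ≫ ιₐ) ≫ c ≫ e⁻¹ = 𝟙`
    have htot : ∑ a, biproduct.π (fun _ : I => unitModule X) a ≫
        biproduct.ι (fun _ : I => unitModule X) a = 𝟙 _ :=
      Limits.IsBilimit.total (biproduct.isBilimit fun _ : I => unitModule X)
    have h : ∀ a, (e.hom ≫ c.inv ≫ biproduct.π (fun _ : I => unitModule X) a) ≫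
        (biproduct.ι (fun _ : I => unitModule X) a ≫ c.hom ≫ e.inv) =
        e.hom ≫ (c.inv ≫ ((biproduct.π (fun _ : I => unitModule X) a ≫
          biproduct.ι (fun _ : I => unitModule X) a) ≫ (c.hom ≫ e.inv))) := fun a => by
      simp only [Category.assoc]
    simp_rw [h]
    rw [← Preadditive.comp_sum, ← Preadditive.comp_sum, ← Preadditive.sum_comp, htot,
      Category.id_comp, Iso.inv_hom_id_assoc, Iso.hom_inv_id]
  · simp only [Category.assoc, Iso.hom_inv_id_assoc, Iso.inv_hom_id_assoc, biproduct.ι_π_self]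
  · simp only [Category.assoc, Iso.hom_inv_id_assoc, Iso.inv_hom_id_assoc, biproduct.ι_π_ne _ hab]
  · simp only [← hc]
    exact (Category.assoc _ _ _).symm

end Literature.AlgebraicGeometry.Modules

/-! ## The tangent and cotangent frames of an abelian variety over a field -/

namespace Literature.AlgebraicGeometry.Motives.AbelianVariety

open Literature.AlgebraicGeometry.Modules Literature.AlgebraicGeometry.HodgeTheory

variable {k : Type} [Field k] (A : AbelianVariety k)

/-- **The tangent frame of an abelian variety as module maps**: a frame `e : 𝒯_A ≅ 𝒪_A^{dim A}`
(tree `nonempty_tangentSheaf_iso_free`; [MumfordAV1970] §4 (iii) dualised) together with projections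
`π_a : 𝒯_A ⟶ 𝒪_A` and inclusions `σ_a = ιFree a ≫ e⁻¹ : 𝒪_A ⟶ 𝒯_A` with `∑_a π_a ≫ σ_a = 𝟙`,
`σ_a ≫ π_b = δ_{ab}`. [cite: MumfordAV1970, §4 (iii) (p. 42)] [cite: Hartshorne1977, II §5 (p. 109)] -/
theorem exists_frameMaps_tangentSheaf :
    ∃ (e : tangentSheaf A.X ≅ SheafOfModules.free (R := A.X.left.ringCatSheaf) (Fin A.dim))
      (π : Fin A.dim → (tangentSheaf A.X ⟶ unitModule A.X.left))
      (σ : Fin A.dim → (unitModule A.X.left ⟶ tangentSheaf A.X)),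
      (∑ a, π a ≫ σ a = 𝟙 _) ∧ (∀ a, σ a ≫ π a = 𝟙 _) ∧ (∀ a b, a ≠ b → σ a ≫ π b = 0) ∧
        ∀ a, σ a = SheafOfModules.ιFree (R := A.X.left.ringCatSheaf) a ≫ e.inv := by
  obtain ⟨e⟩ := nonempty_tangentSheaf_iso_free A
  obtain ⟨π, σ, h⟩ := exists_frameMaps_of_iso_free (Fin A.dim) e
  exact ⟨e, π, σ, h⟩

/-- **The cotangent frame of an abelian variety as module maps**: a frame `e : Ω¹_A ≅ 𝒪_A^{dim A}`
([MumfordAV1970] §4 (iii): «`Ω¹` is free, generated by the invariant differentials»; tree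
`Mumford1970_cotangentSheaf_abelianVariety_free_holds`) with projections `π_a : Ω¹_A ⟶ 𝒪_A` and
inclusions `σ_a = ιFree a ≫ e⁻¹` (the basis differentials), `∑_a π_a ≫ σ_a = 𝟙`, `σ_a ≫ π_b = δ_{ab}`.
[cite: MumfordAV1970, §4 (iii) (p. 42)] [cite: Hartshorne1977, II §5 (p. 109)] -/
theorem exists_frameMaps_cotangentSheaf :
    ∃ (e : cotangentSheaf A.X ≅ SheafOfModules.free (R := A.X.left.ringCatSheaf) (Fin A.dim))
      (π : Fin A.dim → (cotangentSheaf A.X ⟶ unitModule A.X.left))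
      (σ : Fin A.dim → (unitModule A.X.left ⟶ cotangentSheaf A.X)),
      (∑ a, π a ≫ σ a = 𝟙 _) ∧ (∀ a, σ a ≫ π a = 𝟙 _) ∧ (∀ a b, a ≠ b → σ a ≫ π b = 0) ∧
        ∀ a, σ a = SheafOfModules.ιFree (R := A.X.left.ringCatSheaf) a ≫ e.inv := by
  obtain ⟨e⟩ := Mumford1970_cotangentSheaf_abelianVariety_free_holds k A
  obtain ⟨π, σ, h⟩ := exists_frameMaps_of_iso_free (Fin A.dim) e
  exact ⟨e, π, σ, h⟩

end Literature.AlgebraicGeometry.Motives.AbelianVariety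

/-! ## The tangent and cotangent frames of an abelian scheme over a local ring -/

namespace Literature.AlgebraicGeometry.AbelianSchemes.AbelianSchemeOver

open Literature.AlgebraicGeometry.Modules Literature.AlgebraicGeometry.HodgeTheory
open Literature.AlgebraicGeometry.Motives

variable {R : Type} [CommRing R] [IsLocalRing R] (A : AbelianSchemeOver (Spec (CommRingCat.of R)))
  {g : ℕ}

/-- **The tangent frame of an abelian scheme of relative dimension `g` over a LOCAL ring as module maps**
(`e : 𝒯_{A/R} ≅ 𝒪_A^g`, tree `nonempty_tangentSheaf_iso_free_of_isLocalRing`): projections `π_a`,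
inclusions `σ_a = ιFree a ≫ e⁻¹`, `∑_a π_a ≫ σ_a = 𝟙`, `σ_a ≫ π_b = δ_{ab}`.
[cite: BoschLutkebohmertRaynaud1990, §4.2 Prop. 2] [cite: MumfordAV1970, §4 (iii) (p. 42)] -/
theorem exists_frameMaps_tangentSheaf_of_isLocalRing (hA : A.IsOfRelDim g) :
    ∃ (e : tangentSheaf A.X ≅ SheafOfModules.free (R := A.X.left.ringCatSheaf) (Fin g))
      (π : Fin g → (tangentSheaf A.X ⟶ unitModule A.X.left))
      (σ : Fin g → (unitModule A.X.left ⟶ tangentSheaf A.X)),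
      (∑ a, π a ≫ σ a = 𝟙 _) ∧ (∀ a, σ a ≫ π a = 𝟙 _) ∧ (∀ a b, a ≠ b → σ a ≫ π b = 0) ∧
        ∀ a, σ a = SheafOfModules.ιFree (R := A.X.left.ringCatSheaf) a ≫ e.inv := by
  obtain ⟨e⟩ := nonempty_tangentSheaf_iso_free_of_isLocalRing A hA
  obtain ⟨π, σ, h⟩ := exists_frameMaps_of_iso_free (Fin g) e
  exact ⟨e, π, σ, h⟩

/-- **The cotangent frame of an abelian scheme of relative dimension `g` over a LOCAL ring as module
maps** (`e : Ω¹_{A/R} ≅ 𝒪_A^g`, tree `nonempty_cotangentSheaf_iso_free_of_isLocalRing`): projections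
`π_a`, inclusions `σ_a = ιFree a ≫ e⁻¹`, `∑_a π_a ≫ σ_a = 𝟙`, `σ_a ≫ π_b = δ_{ab}`.
[cite: BoschLutkebohmertRaynaud1990, §4.2 Prop. 2] [cite: MumfordAV1970, §4 (iii) (p. 42)] -/
theorem exists_frameMaps_cotangentSheaf_of_isLocalRing (hA : A.IsOfRelDim g) :
    ∃ (e : cotangentSheaf A.X ≅ SheafOfModules.free (R := A.X.left.ringCatSheaf) (Fin g))
      (π : Fin g → (cotangentSheaf A.X ⟶ unitModule A.X.left))
      (σ : Fin g → (unitModule A.X.left ⟶ cotangentSheaf A.X)),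
      (∑ a, π a ≫ σ a = 𝟙 _) ∧ (∀ a, σ a ≫ π a = 𝟙 _) ∧ (∀ a b, a ≠ b → σ a ≫ π b = 0) ∧
        ∀ a, σ a = SheafOfModules.ιFree (R := A.X.left.ringCatSheaf) a ≫ e.inv := by
  obtain ⟨e⟩ := nonempty_cotangentSheaf_iso_free_of_isLocalRing A hA
  obtain ⟨π, σ, h⟩ := exists_frameMaps_of_iso_free (Fin g) e
  exact ⟨e, π, σ, h⟩

end Literature.AlgebraicGeometry.AbelianSchemes.AbelianSchemeOver

end
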